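import Literature.NumberTheory.CubicFields.CubicResolventCharacter
import Literature.NumberTheory.LFunctions.CubicRayClassGeneratorsQuadratic
import Literature.NumberTheory.CubicFields.ThreeTorsionBridge
import HarnessLib

/-!
# Cubic fields of discriminant `d_k f²` are at most `3^{81} · 3^{ω(f)} · #Cl(k)[3]`

`Proofs` file (theorems only), topic `Literature/NumberTheory/CubicFields`: the per-discriminant
class-field-theoretic bound in the uniformity estimate (Davenport–Heilbronn 1971, Prop. 1 /
Belabas–Bhargava–Pomerance 2010, Lemma 3.3 / Bhargava–Shankar–Tsimerman 2013, §8.2: "the number of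
cubic fields `K` with `Disc(K) = D₀ f²` is `O(3^{ω(f)} #Cl(D₀)[3])`, by the classical bound for the
`3`-rank of the ring class group of conductor `f`"), for a quadratic field `k` of discriminant `D₀`:

`cubicFieldCountOfDisc (d_k · f²) ≤ 3^{#(𝓞_k/9)} · 3^{ω(f)} · #Cl(k)[3]`
(`cubicFieldCountOfDisc_mul_sq_le`).

Proof (the injective half of Hasse's theorem, on the tree's proved class field theory): to a cubic
field `K` with `d_K = d_k f²` attach its `S₃`-closure `L = K k ⊆ k̄`, cyclic cubic over `k`
(`CubicResolventClosure.exists_resolventClosure`), an injective character `χ` of `Gal(L/k)` and the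
prime-value function `ψ_K` of its Hecke character off the primes `T` dividing `3 d_k f²`
(`CubicResolventCharacter`): a cubic Dirichlet character modulo a `T`-supported modulus killing the
rational integers prime to `T` (ring class property, `idealPow_span_intCast_eq_one`).  `ψ_{K₁} = ψ_{K₂}`
forces `L₁ = L₂` (Bauer) and then `K₁ ≅ K₂` (the cubic subfields of `L` are conjugate), so the number
of isomorphism classes is at most the number of such functions, which is
`≤ 3^{#S} · #Cl(k)[3]` (`ncard_cubicRayClassFunctions_le`) with `#S ≤ #(𝓞_k/9) + #{p ∣ f}` generators
of `(𝓞_k/𝔪₀)ˣ` modulo rational integers (`exists_generators_baseModulus_quadratic`: no generator at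
the primes dividing `d_k`).

## References

* H. Davenport, H. Heilbronn, *On the density of discriminants of cubic fields. II*, Proc. Roy. Soc.
  A 322 (1971), §6 and Prop. 1 [DavenportHeilbronn1971].
* K. Belabas, M. Bhargava, C. Pomerance, *Error estimates for the Davenport–Heilbronn theorems*,
  Duke Math. J. 153 (2010), Lemma 3.3 [BelabasBhargavaPomerance2010].
* H. Hasse, *Arithmetische Theorie der kubischen Zahlkörper auf klassenkörpertheoretischer Grundlage*,
  Math. Z. 31 (1930) [Hasse1930].
-/

noncomputable section

open NumberField Module IntermediateField IsDedekindDomain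
open scoped Pointwise

namespace Literature.NumberTheory.CubicFields

open Literature.NumberTheory.NumberFields Literature.NumberTheory.QuadraticFields
  Literature.NumberTheory.GaloisRepresentations Literature.NumberTheory.LFunctions
  Literature.NumberTheory.Automorphic

variable {k : Type} [Field k] [NumberField k] [IsGalois ℚ k]

open scoped Classical in
/-- **The cubic ring class character of a cubic field `K` with `d_K = d_k f²`.**  For `T ⊇` the
primes dividing `3 d_k f²` there are: the `S₃`-closure `L ⊆ k̄` of `K` (abelian cubic over `k`,
Galois of degree `6` over `ℚ`, receiving `K`, unramified over `k` outside `T`), an injective character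
`χ` of `Gal(L/k)`, and the function `ψ(𝔭) = ω_χ(ϖ_𝔭)` off `T` (`0` on `T`) is a cubic Dirichlet
character modulo a nonzero `T`-supported modulus with `ψ((a)) = 1` for every rational integer `a`
prime to `T`. [cite: DavenportHeilbronn1971, §6] [cite: Hasse1930, §1] -/
theorem exists_cubicRayClassFunction (hk : finrank ℚ k = 2) (K : Type) [Field K] [NumberField K]
    (hK : finrank ℚ K = 3) {f : ℤ} (hf : f ≠ 0) (hd : discr K = discr k * f ^ 2)
    (T : Finset (HeightOneSpectrum (𝓞 k)))
    (hT3 : ∀ v : HeightOneSpectrum (𝓞 k), (3 : 𝓞 k) ∈ v.asIdeal → v ∈ T)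
    (hTd : ∀ v : HeightOneSpectrum (𝓞 k), v ∉ T → ((discr k * f ^ 2 : ℤ) : 𝓞 k) ∉ v.asIdeal)
    (hTdisc : ∀ v : HeightOneSpectrum (𝓞 k), ((discr k : ℤ) : 𝓞 k) ∈ v.asIdeal → v ∈ T) :
    ∃ (L : IntermediateField k (AlgebraicClosure k)) (_ : FiniteDimensional k L) (_ : IsAbelianGalois k L)
      (_ : IsGalois ℚ L) (_ : NumberField L) (χ : (L ≃ₐ[k] L) →* ℂˣ),
      Function.Injective χ ∧ finrank ℚ L = 6 ∧ Nonempty (K →ₐ[ℚ] L) ∧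
      (∀ v : HeightOneSpectrum (𝓞 k), v ∉ T → Algebra.IsUnramifiedIn (𝓞 L) v.asIdeal) ∧
      ((∃ 𝔪 : Ideal (𝓞 k), 𝔪 ≠ ⊥ ∧ (∀ v : HeightOneSpectrum (𝓞 k), 𝔪 ≤ v.asIdeal → v ∈ T) ∧
          IsRayClassCharacter 𝔪 (fun v => if v ∈ T then (0 : ℂ) else
            (charHecke L χ artinReciprocity_character_holds).valueAtUniformizer v)) ∧
        (∀ v : HeightOneSpectrum (𝓞 k), v ∉ T → (fun v => if v ∈ T then (0 : ℂ) else
            (charHecke L χ artinReciprocity_character_holds).valueAtUniformizer v) v ^ 3 = 1) ∧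
        (∀ v ∈ T, (fun v => if v ∈ T then (0 : ℂ) else
            (charHecke L χ artinReciprocity_character_holds).valueAtUniformizer v) v = 0) ∧
        ∀ z ∈ {y : 𝓞 k | ∃ a : ℤ, y = a ∧ ∀ v ∈ T, ((a : ℤ) : 𝓞 k) ∉ v.asIdeal},
          idealPow k (fun v => if v ∈ T then (0 : ℂ) else
            (charHecke L χ artinReciprocity_character_holds).valueAtUniformizer v) (Ideal.span {z}) = 1) := by
  obtain ⟨L, hfd, h3, hab, hgal, h6, ⟨ι⟩, hgen⟩ := exists_resolventClosure hk K hK hf hd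
  haveI := hfd
  haveI := hab
  haveI := hgal
  haveI : FiniteDimensional ℚ L := Module.Finite.trans k L
  haveI : CharZero L := charZero_of_injective_algebraMap (algebraMap k L).injective
  haveI hnf : NumberField L := NumberField.mk
  have hcard : Nat.card (L ≃ₐ[k] L) = 3 := by rw [IsGalois.card_aut_eq_finrank, h3]
  obtain ⟨χ, hχ⟩ := exists_injective_character L hcard
  have hKG : ¬ IsGalois ℚ K := not_isGalois_of_discr_eq_mul_sq hk K hK hf hd
  have hunr : ∀ v : HeightOneSpectrum (𝓞 k), v ∉ T → Algebra.IsUnramifiedIn (𝓞 L) v.asIdeal :=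
    fun v hv => isUnramifiedIn_of_intCast_not_mem L (d := discr k * f ^ 2)
      (fun p hp hpL => by rw [← hd]; exact dvd_discr_of_dvd_discr_of_iSup_fieldRange_eq_top K L hgen hp hpL)
      v (hTd v hv)
  obtain ⟨hray, hcube, hzero⟩ := cubicRayClassFunction_spec L χ hcard T hunr
  refine ⟨L, hfd, hab, hgal, hnf, χ, hχ, h6, ⟨ι⟩, hunr, hray, hcube, hzero, ?_⟩
  rintro z ⟨a, rfl, haT⟩
  have ha : a ≠ 0 := by
    rintro rfl
    obtain ⟨v, hv⟩ := exists_mem_of_prime (K := k) Nat.prime_three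
    exact haT v (hT3 v (by exact_mod_cast hv)) (by rw [Int.cast_zero]; exact v.asIdeal.zero_mem)
  exact idealPow_span_intCast_eq_one L hk h3 hKG ι χ T hunr hTdisc ha haT

omit [IsGalois ℚ k] in
open scoped Classical in
/-- **Equal ring class characters force isomorphic cubic fields** (Hasse: the cubic subfields of the
`S₃`-closure are conjugate; Bauer: the prime-value function determines `L`). [cite: Hasse1930, §1] -/
theorem nonempty_algEquiv_of_cubicRayClassFunction_eq
    (L₁ L₂ : IntermediateField k (AlgebraicClosure k)) [FiniteDimensional k L₁] [IsAbelianGalois k L₁]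
    [IsGalois ℚ L₁] [NumberField L₁] [FiniteDimensional k L₂] [IsAbelianGalois k L₂] [IsGalois ℚ L₂]
    [NumberField L₂] (h6 : finrank ℚ L₁ = 6)
    (χ₁ : (L₁ ≃ₐ[k] L₁) →* ℂˣ) (χ₂ : (L₂ ≃ₐ[k] L₂) →* ℂˣ) (hχ₁ : Function.Injective χ₁)
    (hχ₂ : Function.Injective χ₂) (T : Finset (HeightOneSpectrum (𝓞 k)))
    (hunr₁ : ∀ v : HeightOneSpectrum (𝓞 k), v ∉ T → Algebra.IsUnramifiedIn (𝓞 L₁) v.asIdeal)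
    (hunr₂ : ∀ v : HeightOneSpectrum (𝓞 k), v ∉ T → Algebra.IsUnramifiedIn (𝓞 L₂) v.asIdeal)
    {K₁ : Type} [Field K₁] [NumberField K₁] (hK₁ : finrank ℚ K₁ = 3) (ι₁ : K₁ →ₐ[ℚ] L₁)
    {K₂ : Type} [Field K₂] [NumberField K₂] (hK₂ : finrank ℚ K₂ = 3) (ι₂ : K₂ →ₐ[ℚ] L₂)
    (h : (fun v => if v ∈ T then (0 : ℂ) else
        (charHecke L₁ χ₁ artinReciprocity_character_holds).valueAtUniformizer v) =
      (fun v => if v ∈ T then (0 : ℂ) else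
        (charHecke L₂ χ₂ artinReciprocity_character_holds).valueAtUniformizer v)) :
    Nonempty (K₁ ≃ₐ[ℚ] K₂) := by
  have hL : L₁ = L₂ := eq_of_cubicRayClassFunction_eq L₁ L₂ χ₁ χ₂ hχ₁ hχ₂ T hunr₁ hunr₂ h
  subst hL
  exact nonempty_algEquiv_of_algHom_of_finrank_eq_six L₁ h6 hK₁ ι₁ hK₂ ι₂

/-- `#(𝓞_k/9) = 9^{[k:ℚ]}`. [folklore] -/
theorem natCard_quotient_span_nine (K : Type*) [Field K] [NumberField K] :
    Nat.card (𝓞 K ⧸ Ideal.span {(9 : 𝓞 K)}) = 9 ^ finrank ℚ K := by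
  rw [← absNorm_eq_card, show (9 : 𝓞 K) = (((9 : ℕ) : ℤ) : 𝓞 K) by norm_num, absNorm_span_natCast]

open scoped Classical in
/-- **`#{K : d_K = d_k f²}/≅ ≤ 3^{#(𝓞_k/9)} · 3^{ω(f)} · #Cl(k)[3]`** for a quadratic field `k` and
`f ≠ 0` — the class-field-theoretic per-discriminant bound of the uniformity estimate
(Davenport–Heilbronn 1971, Prop. 1; Belabas–Bhargava–Pomerance 2010, Lemma 3.3: `3`-rank of the ring
class group of conductor `f` is `≤ ω(f) + r₃(d_k) + O(1)`), through the injection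
`K ↦ ψ_K` into the cubic Dirichlet characters modulo `T`-supported moduli killing `ℤ`
(`exists_cubicRayClassFunction`, `nonempty_algEquiv_of_cubicRayClassFunction_eq`) and the count
`ncard_cubicRayClassFunctions_le` fed by `exists_generators_baseModulus_quadratic`.
[cite: DavenportHeilbronn1971, Prop. 1] [cite: BelabasBhargavaPomerance2010, Lemma 3.3] -/
theorem cubicFieldCountOfDisc_mul_sq_le (hk : finrank ℚ k = 2) {f : ℤ} (hf : f ≠ 0) :
    cubicFieldCountOfDisc (discr k * f ^ 2) ≤
      3 ^ Nat.card (𝓞 k ⧸ Ideal.span {(9 : 𝓞 k)}) * 3 ^ f.natAbs.primeFactors.card *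
        Nat.card {c : ClassGroup (𝓞 k) // c ^ 3 = 1} := by
  set d : ℤ := discr k * f ^ 2 with hddef
  have hdk : discr k ≠ 0 := discr_ne_zero k
  have hd0 : d ≠ 0 := mul_ne_zero hdk (pow_ne_zero 2 hf)
  have h3d : ((3 * d : ℤ) : 𝓞 k) ≠ 0 := by exact_mod_cast (mul_ne_zero (by norm_num) hd0)
  have hI : Ideal.span {((3 * d : ℤ) : 𝓞 k)} ≠ ⊥ := by rwa [Ne, Ideal.span_singleton_eq_bot]
  -- `T` = primes dividing `3d`
  set T : Finset (HeightOneSpectrum (𝓞 k)) := (Ideal.finite_factors hI).toFinset with hTdef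
  have hT : ∀ v : HeightOneSpectrum (𝓞 k), v ∈ T ↔ ((3 * d : ℤ) : 𝓞 k) ∈ v.asIdeal := by
    intro v
    rw [hTdef, Set.Finite.mem_toFinset, Set.mem_setOf_eq, Ideal.dvd_span_singleton]
  have hT3 : ∀ v : HeightOneSpectrum (𝓞 k), (3 : 𝓞 k) ∈ v.asIdeal → v ∈ T := fun v h3 =>
    (hT v).mpr (by rw [Int.cast_mul, Int.cast_ofNat]; exact Ideal.mul_mem_right _ _ h3)
  have hTd : ∀ v : HeightOneSpectrum (𝓞 k), v ∉ T → ((discr k * f ^ 2 : ℤ) : 𝓞 k) ∉ v.asIdeal :=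
    fun v hv hmem => hv ((hT v).mpr (by rw [Int.cast_mul]; exact Ideal.mul_mem_left _ _ hmem))
  have hTdisc : ∀ v : HeightOneSpectrum (𝓞 k), ((discr k : ℤ) : 𝓞 k) ∈ v.asIdeal → v ∈ T := by
    intro v hmem
    refine (hT v).mpr ?_
    have : ((3 * d : ℤ) : 𝓞 k) = (3 * f ^ 2 : 𝓞 k) * ((discr k : ℤ) : 𝓞 k) := by
      rw [hddef]; push_cast; ring
    rw [this]
    exact Ideal.mul_mem_left _ _ hmem
  have hTne : T.Nonempty := by
    obtain ⟨v, hv⟩ := exists_mem_of_prime (K := k) Nat.prime_three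
    exact ⟨v, hT3 v (by exact_mod_cast hv)⟩
  -- the rational integers prime to `T`, and the generators
  set Z : Set (𝓞 k) := {y : 𝓞 k | ∃ a : ℤ, y = a ∧ ∀ v ∈ T, ((a : ℤ) : 𝓞 k) ∉ v.asIdeal} with hZdef
  have hZT : ∀ z ∈ Z, ∀ v ∈ T, z ∉ v.asIdeal := by
    rintro z ⟨a, rfl, haT⟩ v hv
    exact haT v hv
  obtain ⟨S, hScard, hST, hgen⟩ := exists_generators_baseModulus_quadratic hk hd0 T hT
  obtain ⟨hΨfin, hΨcard⟩ := ncard_cubicRayClassFunctions_le T hTne hT3 hZT S hST hgen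
  -- the data attached to each cubic field of discriminant `d`
  have hdata := fun K : cubicSubfieldsOfDisc d =>
    exists_cubicRayClassFunction hk K K.2.1 hf K.2.2 T hT3 hTd hTdisc
  choose L hLfd hLab hLgal hLnf χ hχ h6 hemb hunr hΨ using hdata
  set hR := artinReciprocity_character_holds
  -- the map to the finite set of functions
  set Ψ : Set (HeightOneSpectrum (𝓞 k) → ℂ) := {ψ |
      (∃ 𝔪 : Ideal (𝓞 k), 𝔪 ≠ ⊥ ∧ (∀ v : HeightOneSpectrum (𝓞 k), 𝔪 ≤ v.asIdeal → v ∈ T) ∧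
        IsRayClassCharacter 𝔪 ψ) ∧
      (∀ v, v ∉ T → ψ v ^ 3 = 1) ∧ (∀ v ∈ T, ψ v = 0) ∧
      ∀ z ∈ Z, idealPow k ψ (Ideal.span {z}) = 1} with hΨdef
  haveI : Finite Ψ := hΨfin.to_subtype
  set ψ : cubicSubfieldsOfDisc d → (HeightOneSpectrum (𝓞 k) → ℂ) := fun K => by
    haveI := hLfd K; haveI := hLab K; haveI := hLnf K
    exact fun v => if v ∈ T then (0 : ℂ) else (charHecke (L K) (χ K) hR).valueAtUniformizer v
    with hψdef
  have hψmem : ∀ K, ψ K ∈ Ψ := fun K => hΨ K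
  set Φ : CubicFieldClassesOfDisc d → Ψ := fun c => ⟨ψ c.out, hψmem c.out⟩ with hΦdef
  have hΦ : Function.Injective Φ := by
    intro c₁ c₂ hc
    have hψeq : ψ c₁.out = ψ c₂.out := congrArg Subtype.val hc
    haveI := hLfd c₁.out; haveI := hLab c₁.out; haveI := hLgal c₁.out; haveI := hLnf c₁.out
    haveI := hLfd c₂.out; haveI := hLab c₂.out; haveI := hLgal c₂.out; haveI := hLnf c₂.out
    obtain ⟨ι₁⟩ := hemb c₁.out
    obtain ⟨ι₂⟩ := hemb c₂.out
    have hiso : Nonempty ((c₁.out : cubicSubfieldsOfDisc d).1 ≃ₐ[ℚ] (c₂.out : cubicSubfieldsOfDisc d).1) :=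
      nonempty_algEquiv_of_cubicRayClassFunction_eq (L c₁.out) (L c₂.out) (h6 c₁.out) (χ c₁.out) (χ c₂.out)
        (hχ c₁.out) (hχ c₂.out) T (hunr c₁.out) (hunr c₂.out) c₁.out.2.1 ι₁ c₂.out.2.1 ι₂ hψeq
    rw [← Quotient.out_eq c₁, ← Quotient.out_eq c₂]
    exact Quotient.sound hiso
  -- counting
  have hcount : cubicFieldCountOfDisc d ≤ Ψ.ncard := by
    rw [cubicFieldCountOfDisc, ← Nat.card_coe_set_eq]
    exact Nat.card_le_card_of_injective Φ hΦ
  have hfilter : (d.natAbs.primeFactors.filter fun p : ℕ => ¬ ((p : ℤ) ∣ discr k)).card ≤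
      f.natAbs.primeFactors.card := by
    refine Finset.card_le_card fun p hp => ?_
    obtain ⟨hpd, hpk⟩ := Finset.mem_filter.mp hp
    have hpp : p.Prime := Nat.prime_of_mem_primeFactors hpd
    have hdvd : p ∣ d.natAbs := Nat.dvd_of_mem_primeFactors hpd
    rw [hddef, Int.natAbs_mul, Int.natAbs_pow] at hdvd
    rcases (Nat.Prime.dvd_mul hpp).mp hdvd with h | h
    · exact absurd (Int.natCast_dvd.mpr h) hpk
    · exact Nat.mem_primeFactors.mpr ⟨hpp, hpp.dvd_of_dvd_pow h, Int.natAbs_ne_zero.mpr hf⟩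
  calc cubicFieldCountOfDisc d ≤ Ψ.ncard := hcount
    _ ≤ 3 ^ S.card * Nat.card {c : ClassGroup (𝓞 k) // c ^ 3 = 1} := hΨcard
    _ ≤ 3 ^ (Nat.card (𝓞 k ⧸ Ideal.span {(9 : 𝓞 k)}) + f.natAbs.primeFactors.card) *
          Nat.card {c : ClassGroup (𝓞 k) // c ^ 3 = 1} := by
        refine Nat.mul_le_mul_right _ (Nat.pow_le_pow_right (by norm_num) (hScard.trans ?_))
        exact Nat.add_le_add_left hfilter _
    _ = 3 ^ Nat.card (𝓞 k ⧸ Ideal.span {(9 : 𝓞 k)}) * 3 ^ f.natAbs.primeFactors.card *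
          Nat.card {c : ClassGroup (𝓞 k) // c ^ 3 = 1} := by rw [pow_add]

end Literature.NumberTheory.CubicFields

end
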